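import Literature.AlgebraicTopology.Homotopy.SequenceTelescopeCW
import Literature.AlgebraicTopology.Homotopy.ManifoldCompactFactorization
import Literature.AlgebraicTopology.Homotopy.CWComplexTransfer
import Literature.AlgebraicTopology.Homotopy.ManifoldCWType
import Mathlib.Topology.CWComplex.Classical.Finite
import Mathlib.Topology.UrysohnsLemma
import Mathlib.Algebra.BigOperators.Finprod
import Mathlib.Topology.Algebra.Monoid
import Mathlib.Topology.Metrizable.Urysohn
import Mathlib.Topology.Compactness.SigmaCompact
import HarnessLib

/-!
# Manifolds have the homotopy type of countable CW complexes, given cellular approximation (Milnor 1959, Cor. 1)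

Topic `Literature/AlgebraicTopology/Homotopy`. The named fact
`Literature.AlgebraicTopology.Homotopy.Manifold.exists_cwComplex_homotopyEquiv`
(`WhiteheadContractibleLeaves.lean`; Milnor, *On spaces having the homotopy type of a
CW-complex* (1959), Cor. 1: every separable manifold has the homotopy type of a countable
CW-complex) is PROVED here up to a single remaining named fact, Hatcher's cellular approximation
theorem (`cellularApproximation`, Thm. 4.8), by the telescope route assembled from the tree:

  `M ≃ T(K₀ ↪ K₁ ↪ ⋯)` (compact exhaustion + height function, `homotopyEquivExhaustion`)
  `≃ T(bⱼ ∘ aⱼ)` (the small homotopies `incl ≃ bⱼ ∘ Fⱼ` of `exists_cube_factorization`, fact (1))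
  `≃ T(aⱼ₊₁ ∘ bⱼ)` on the finite cube complexes (domination swap `homotopyEquivOfFactorization`)
  `≃ T(c'ⱼ)`, `c'ⱼ` cellular approximations (fact (1)), a countable Hausdorff CW complex
  (`SeqTelescope.cwComplex`, `countable_tcell`), lifted to the universe of `M` (`CWTransfer`).

* `Manifold.exists_countable_cwComplex_homotopyEquiv_of_cellularApproximation` (main theorem),
  `Manifold.exists_cwComplex_homotopyEquiv_of_cellularApproximation` (= the target fact from
  `cellularApproximation.{0,0}`), `Manifold.countable_cwDominated_of_cellularApproximation`
  (Milnor Thm. 1 (d)⇒(b) for manifolds, likewise);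
* tools: `exists_height_function` (Urysohn), `countable_cells_of_finite`,
  `countable_cells_of_discrete` (the empty manifold, with Mathlib's `CWComplex.ofDiscreteTopology`).

No `sorry`; the only hypothesis left is `cellularApproximation`.

## References

* J. Milnor, *On spaces having the homotopy type of a CW-complex*, Trans. AMS 90 (1959),
  Thm. 1 and Cor. 1 (pp. 272–273). [Milnor1959]
* A. Hatcher, *Algebraic Topology*, CUP (2002), §4.1 Thm. 4.8; Appendix, Prop. A.11 (p. 528).
  [HatcherAT2002]
-/

noncomputable section

open Set Metric Function Topology unitInterval
open scoped ContinuousMap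
open Literature.Topology.Euclidean Literature.Topology.Euclidean.LatticeCube

universe u

namespace Literature.AlgebraicTopology.Homotopy

/-! ### A height function for a compact exhaustion -/

/-- **Height functions exist**: for compact sets `K j` of a Hausdorff locally compact space with
`K j ⊆ interior (K (j+1))` and `⋃ K j = M` there is a continuous `h ≥ 0` with `x ∈ K_{⌊h x⌋}`
for all `x` (Urysohn functions `uⱼ = 0` on `K j`, `= 1` off `interior K (j+1)`, and
`h = 1 + ∑ uⱼ`, a locally finite sum). [folklore] -/
theorem exists_height_function {M : Type*} [TopologicalSpace M] [T2Space M] [LocallyCompactSpace M]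
    (K : ℕ → Set M) (hKc : ∀ j, IsCompact (K j)) (hKi : ∀ j, K j ⊆ interior (K (j + 1)))
    (hKu : ⋃ j, K j = univ) :
    ∃ h : C(M, ℝ), (∀ x, 0 ≤ h x) ∧ ∀ x, x ∈ K ⌊h x⌋₊ := by
  have hmono : ∀ i j, i ≤ j → K i ⊆ K j := by
    intro i j hij
    induction hij with
    | refl => exact Subset.rfl
    | step _ ih => exact ih.trans ((hKi _).trans interior_subset)
  -- Urysohn functions
  have hu : ∀ j, ∃ u : C(M, ℝ), EqOn u 0 (K j) ∧ EqOn u 1 (interior (K (j + 1)))ᶜ ∧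
      ∀ x, u x ∈ Icc (0 : ℝ) 1 := fun j =>
    exists_continuous_zero_one_of_isCompact (hKc j) isOpen_interior.isClosed_compl
      (disjoint_compl_right_iff_subset.2 (hKi j))
  choose u hu0 hu1 hu01 using hu
  -- local finiteness of the supports
  have hcov : ∀ x, ∃ m, x ∈ interior (K m) := by
    intro x
    have hx : x ∈ ⋃ j, K j := by rw [hKu]; exact mem_univ x
    obtain ⟨j, hj⟩ := mem_iUnion.1 hx
    exact ⟨j + 1, hKi j hj⟩
  have hlf : LocallyFinite fun j => support (u j) := by
    intro x
    obtain ⟨m, hm⟩ := hcov x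
    refine ⟨interior (K m), isOpen_interior.mem_nhds hm, (finite_lt_nat m).subset ?_⟩
    rintro j ⟨y, hyj, hym⟩
    by_contra hjm
    have hle : m ≤ j := not_lt.1 hjm
    have : u j y = 0 := hu0 j (hmono m j hle (interior_subset hym))
    exact hyj this
  have hcont : Continuous fun x => ∑ᶠ j, u j x :=
    continuous_finsum (fun j => (u j).continuous) hlf
  refine ⟨⟨fun x => 1 + ∑ᶠ j, u j x, continuous_const.add hcont⟩, fun x => ?_, fun x => ?_⟩
  · have : 0 ≤ ∑ᶠ j, u j x := finsum_nonneg fun j => (hu01 j x).1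
    show 0 ≤ 1 + ∑ᶠ j, u j x
    linarith
  · show x ∈ K ⌊1 + ∑ᶠ j, u j x⌋₊
    classical
    -- the first index `j₀` with `x ∈ K j₀`
    have hex : ∃ j, x ∈ K j := by
      have hx : x ∈ ⋃ j, K j := by rw [hKu]; exact mem_univ x
      exact mem_iUnion.1 hx
    set j₀ := Nat.find hex with hj₀
    have hxj₀ : x ∈ K j₀ := Nat.find_spec hex
    have hlt : ∀ j < j₀, x ∉ K j := fun j hj => Nat.find_min hex hj
    -- `u j x = 1` for `j + 1 < j₀`
    have hone : ∀ j, j + 1 < j₀ → u j x = 1 := fun j hj =>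
      hu1 j (fun hx' => hlt (j + 1) hj (interior_subset hx'))
    -- lower bound for the sum
    have hsupp : (support fun j => u j x) ⊆ (hlf.point_finite x).toFinset := by
      intro j hj; simpa using hj
    have hsum : ∑ᶠ j, u j x = ∑ j ∈ (hlf.point_finite x).toFinset, u j x :=
      finsum_eq_sum_of_support_subset _ hsupp
    have hge : ((j₀ : ℝ) - 1) ≤ ∑ᶠ j, u j x := by
      rw [hsum]
      have hsub : Finset.range (j₀ - 1) ⊆ (hlf.point_finite x).toFinset := by
        intro j hj
        rw [Finset.mem_range] at hj
        simp only [Finite.mem_toFinset, mem_setOf_eq, mem_support]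
        rw [hone j (by omega)]; exact one_ne_zero
      calc ((j₀ : ℝ) - 1) ≤ ((j₀ - 1 : ℕ) : ℝ) := by
              rcases Nat.eq_zero_or_pos j₀ with h0 | h0
              · rw [h0]; norm_num
              · rw [Nat.cast_sub h0, Nat.cast_one]
        _ = ∑ j ∈ Finset.range (j₀ - 1), (1 : ℝ) := by simp
        _ = ∑ j ∈ Finset.range (j₀ - 1), u j x := by
              refine Finset.sum_congr rfl fun j hj => ?_
              rw [Finset.mem_range] at hj
              rw [hone j (by omega)]
        _ ≤ ∑ j ∈ (hlf.point_finite x).toFinset, u j x :=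
              Finset.sum_le_sum_of_subset_of_nonneg hsub fun j _ _ => (hu01 j x).1
    have hfloor : j₀ ≤ ⌊1 + ∑ᶠ j, u j x⌋₊ := Nat.le_floor (by linarith)
    exact hmono _ _ hfloor hxj₀

/-! ### The main theorem -/

/-- A finite CW complex has countably many cells (Mathlib's `RelCWComplex.finite_cells_of_finite`
and `Finite.to_countable`). [folklore] -/
theorem countable_cells_of_finite {Y : Type*} [TopologicalSpace Y] [CWComplex (univ : Set Y)]
    [RelCWComplex.Finite (univ : Set Y)] : Countable (Σ k, RelCWComplex.cell (univ : Set Y) k) := by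
  haveI := RelCWComplex.finite_cells_of_finite (C := (univ : Set Y)) (D := ∅)
  infer_instance

/-- Mathlib's CW structure `CWComplex.ofDiscreteTopology` on a countable discrete space (all
points are `0`-cells) has countably many cells. [folklore] -/
theorem countable_cells_of_discrete (Y : Type*) [TopologicalSpace Y] [DiscreteTopology Y] [Countable Y] :
    Countable (Σ k, RelCWComplex.cell (C := (univ : Set Y)) k) := by
  haveI : ∀ k, Countable (RelCWComplex.cell (univ : Set Y) k) := by
    intro k
    cases k with
    | zero => exact (inferInstance : Countable (univ : Set Y))
    | succ n => exact (inferInstance : Countable PEmpty)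
  infer_instance

/-- **Every Hausdorff second countable topological `n`-manifold has the homotopy type of a
countable CW complex, GIVEN the cellular approximation theorem** (Milnor 1959, Cor. 1; here by
the telescope route: `M ≃ T(K₀ ↪ K₁ ↪ ⋯)` for a compact exhaustion (`homotopyEquivExhaustion`),
`≃ T(bⱼ ∘ aⱼ)` by the small homotopies of `exists_cube_factorization` (fact (1)),
`≃ T(aⱼ₊₁ ∘ bⱼ)` on the finite cube complexes (domination swap), `≃ T(c'ⱼ)` for cellular
approximations `c'ⱼ` (fact (1) again), a countable Hausdorff CW complex
(`SeqTelescope.cwComplex`), finally lifted to the universe of `M`).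
[cite: Milnor1959, Cor. 1 (p. 272)] -/
theorem Manifold.exists_countable_cwComplex_homotopyEquiv_of_cellularApproximation
    (hCA : cellularApproximation.{0, 0}) (n : ℕ) (M : Type u) [TopologicalSpace M] [T2Space M]
    [SecondCountableTopology M] [ChartedSpace (EuclideanSpace ℝ (Fin n)) M] :
    ∃ (C : Type u) (_ : TopologicalSpace C) (_ : T2Space C) (_ : CWComplex (univ : Set C)),
      Countable (Σ k, RelCWComplex.cell (univ : Set C) k) ∧ Nonempty (M ≃ₕ C) := by
  haveI : LocallyCompactSpace M := ChartedSpace.locallyCompactSpace (EuclideanSpace ℝ (Fin n)) M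
  rcases isEmpty_or_nonempty M with hM | hM
  · haveI : Countable M := Finite.to_countable
    exact ⟨M, inferInstance, inferInstance, inferInstance, countable_cells_of_discrete M,
      ⟨ContinuousMap.HomotopyEquiv.refl M⟩⟩
  -- a compatible metric
  letI : MetricSpace M := TopologicalSpace.metrizableSpaceMetric M
  -- compact exhaustion and height function
  set K := CompactExhaustion.choice M with hKdef
  have hKsub : ∀ j, (K j : Set M) ⊆ K (j + 1) := fun j => K.subset_succ j
  obtain ⟨hgt, hgt0, hgtK⟩ := exists_height_function (fun j => (K j : Set M)) (fun j => K.isCompact j)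
    (fun j => K.subset_interior_succ j) K.iUnion_eq
  -- factorisations of the compact pieces
  have hfac : ∀ j, ∃ (N : ℕ) (h : ℝ) (𝒬 : Finset (Fin N → ℤ)) (F : M → (Fin N → ℝ))
      (b : (Fin N → ℝ) → M) (H : M → ℝ → M),
      0 < h ∧ Continuous F ∧ (∀ x ∈ K j, F x ∈ complex 𝒬 h) ∧ ContinuousOn b (complex 𝒬 h) ∧
      (∀ y ∈ complex 𝒬 h, b y ∈ interior (K (j + 1))) ∧
      ContinuousOn (fun q : M × ℝ => H q.1 q.2) ((K j : Set M) ×ˢ Icc 0 1) ∧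
      (∀ x ∈ K j, H x 0 = x) ∧ (∀ x ∈ K j, H x 1 = b (F x)) ∧
      (∀ x ∈ K j, ∀ t ∈ Icc (0 : ℝ) 1, H x t ∈ interior (K (j + 1))) := fun j =>
    exists_cube_factorization (n := n) (K.isCompact j) isOpen_interior (K.subset_interior_succ j)
  choose N h 𝒬 F b H hh hFc hFK hbc hbU hHc hH0 hH1 hHU using hfac
  -- the finite cube complexes as Hausdorff CW complexes
  let Y : ℕ → Type := fun j => ↥(complex (𝒬 j) (h j))
  letI instCW : ∀ j, CWComplex (univ : Set (Y j)) := fun j => cwComplex (𝒬 j) (h j) (hh j)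
  haveI instFin : ∀ j, RelCWComplex.Finite (univ : Set (Y j)) := fun j => finite_cwComplex (hh j)
  -- the maps `a j : K j → Y j`, `bb j : Y j → K (j + 1)`
  let a : ∀ j, C(↥(K j : Set M), Y j) := fun j =>
    ⟨fun x => ⟨F j x, hFK j x x.2⟩, ((hFc j).comp continuous_subtype_val).subtype_mk _⟩
  let bb : ∀ j, C(Y j, ↥(K (j + 1) : Set M)) := fun j =>
    ⟨fun y => ⟨b j y, interior_subset (hbU j y y.2)⟩,
      ((hbc j).comp_continuous continuous_subtype_val fun y => y.2).subtype_mk _⟩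
  -- the homotopies `incl ≃ bb j ∘ a j`
  have hGt : ∀ j, ∀ (t : I) (x : ↥(K j : Set M)), H j x t ∈ (K (j + 1) : Set M) := fun j t x =>
    interior_subset (hHU j x x.2 t ⟨t.2.1, t.2.2⟩)
  let G : ∀ j, (SeqTelescope.inclSeq (fun j => (K j : Set M)) hKsub j).Homotopy ((bb j).comp (a j)) :=
    fun j =>
    { toFun := fun p => ⟨H j p.2 p.1, hGt j p.1 p.2⟩
      continuous_toFun := by
        refine Continuous.subtype_mk ?_ _
        have hc := hHc j
        exact hc.comp_continuous ((continuous_subtype_val.comp continuous_snd).prodMk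
          (continuous_subtype_val.comp continuous_fst)) fun p => ⟨p.2.2, p.1.2.1, p.1.2.2⟩
      map_zero_left := fun x => Subtype.ext (hH0 j x x.2)
      map_one_left := fun x => Subtype.ext (hH1 j x x.2) }
  -- cellular approximations of `a (j+1) ∘ bb j`
  have hca : ∀ j, ∃ g : C(Y j, Y (j + 1)), IsCellularMap g ∧ ((a (j + 1)).comp (bb j)).Homotopic g :=
    fun j => hCA (Y j) (Y (j + 1)) ((a (j + 1)).comp (bb j))
  choose c' hc' hcc' using hca
  -- the telescope of the cellular approximations, a countable Hausdorff CW complex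
  let T : Type := SeqTelescope (X := Y) c'
  letI instT : CWComplex (univ : Set T) := SeqTelescope.cwComplex (X := Y) c' hc'
  have hTc : Countable (Σ k, RelCWComplex.cell (univ : Set T) k) :=
    SeqTelescope.countable_tcell (X := Y) fun j => countable_cells_of_finite
  -- the chain of homotopy equivalences
  have e1 : M ≃ₕ SeqTelescope (SeqTelescope.inclSeq (fun j => (K j : Set M)) hKsub) :=
    (SeqTelescope.homotopyEquivExhaustion (fun j => (K j : Set M)) hKsub hgt hgt0 hgtK
      fun j => (K.isCompact j).isClosed).symm
  have e2 : SeqTelescope (SeqTelescope.inclSeq (fun j => (K j : Set M)) hKsub) ≃ₕ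
      SeqTelescope (X := fun j => ↥(K j : Set M)) (fun j => (bb j).comp (a j)) :=
    SeqTelescope.homotopyEquivOfHomotopy G
  have e3 : SeqTelescope (X := fun j => ↥(K j : Set M)) (fun j => (bb j).comp (a j)) ≃ₕ
      SeqTelescope (X := Y) (fun j => (a (j + 1)).comp (bb j)) :=
    SeqTelescope.homotopyEquivOfFactorization (X := fun j => ↥(K j : Set M)) (Y := Y)
      (fun j => (bb j).comp (a j)) (fun j => (a (j + 1)).comp (bb j)) a bb (fun _ _ => rfl) (fun _ _ => rfl)
  have e4 : SeqTelescope (X := Y) (fun j => (a (j + 1)).comp (bb j)) ≃ₕ T :=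
    SeqTelescope.homotopyEquivOfHomotopy fun j => (hcc' j).some
  have e : M ≃ₕ T := ((e1.trans e2).trans e3).trans e4
  -- lift to the universe of `M`
  let C : Type u := ULift.{u} T
  letI instC : CWComplex (univ : Set C) :=
    CWTransfer.ofHomeomorph.{0, u} (C := (univ : Set T)) ((Homeomorph.Set.univ T).trans Homeomorph.ulift.{u}.symm)
  refine ⟨C, inferInstance, inferInstance, instC, ?_, ⟨e.trans (Homeomorph.ulift.{u} (X := T)).symm.toHomotopyEquiv⟩⟩
  -- countability of the lifted cells
  have hinj : Function.Injective (fun q : Σ k, RelCWComplex.cell (univ : Set C) k =>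
      (⟨q.1, (q.2 : ULift (RelCWComplex.cell (univ : Set T) q.1)).down⟩ : Σ k, RelCWComplex.cell (univ : Set T) k)) := by
    rintro ⟨k, ⟨i⟩⟩ ⟨k', ⟨i'⟩⟩ hq
    cases hq; rfl
  haveI := hTc
  exact hinj.countable

/-- **Milnor 1959, Corollary 1, GIVEN the cellular approximation theorem**: the named fact
`Manifold.exists_cwComplex_homotopyEquiv` of `WhiteheadContractibleLeaves.lean` (every Hausdorff
second countable topological `n`-manifold has the homotopy type of a countable CW complex)
holds as soon as Hatcher's Thm. 4.8 (`cellularApproximation`, for complexes in `Type 0`) does.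
PROVED (`Manifold.exists_countable_cwComplex_homotopyEquiv_of_cellularApproximation`).
[cite: Milnor1959, Cor. 1 (p. 272)] -/
theorem Manifold.exists_cwComplex_homotopyEquiv_of_cellularApproximation
    (hCA : cellularApproximation.{0, 0}) : Manifold.exists_cwComplex_homotopyEquiv.{u} :=
  fun n M _ _ _ _ => Manifold.exists_countable_cwComplex_homotopyEquiv_of_cellularApproximation hCA n M

/-- **Milnor's domination fact for manifolds, GIVEN cellular approximation**: the named fact
`Manifold.countable_cwDominated` (`ManifoldCWType.lean`, Milnor Thm. 1 (d)⇒(b) for manifolds)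
follows, a homotopy equivalence being a domination. PROVED.
[cite: Milnor1959, Thm. 1 (d)⇒(b) with Cor. 1 (pp. 272–273)] -/
theorem Manifold.countable_cwDominated_of_cellularApproximation (hCA : cellularApproximation.{0, 0}) :
    Manifold.countable_cwDominated.{u} :=
  Manifold.countable_cwDominated_of_exists_cwComplex_homotopyEquiv
    (Manifold.exists_cwComplex_homotopyEquiv_of_cellularApproximation hCA)

end Literature.AlgebraicTopology.Homotopy

end
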